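import Mathlib
import Summits.NavierStokesRegularity.NavierStokesRegularity.Theorems.EulerZoomLiouvillePowerGaugeEulerLiouvilleNeedleBandTest

/-!
# THE BAND LAW, part B: super-level areas of a planar `C¹` function decay geometrically across level bands
# (plate t39b-B of ROUND-38 «the waiting-time exponent», kernel of «Lemma K without symmetry»;
# crux E `PowerGaugeEulerLiouville`, stmt-NavierStokesRegularity-19832)

LANDING PLATE prepared by nsreg-p2 g33 (cell ns-regularity-ideate, TEXT custody DIRECTOR-NS #199 (1)) for a
keyed PROVER hand (`--supports stmt-NavierStokesRegularity-19832 --as helper`); the planner lands nothing.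
Mathlib + part A only.  KERNEL STATEMENTS ONLY — no Euler / Navier–Stokes content.
THE POINT.  ROUND-36/37 bounded the IN-RADIUS of the fast-inflow set of a profile on a good sphere
(length–area / logarithmic capacity of ONE disc) and concluded that its MEASURE is only Chebyshev-small in
general («porosity», ROUND-37 (E1)).  That is too pessimistic: the capacity–area inequality
`cap₂(F; G) ≥ 4π / log(|G|/|F|)` (Maz'ya, Sobolev Spaces §2.2.3 (6), `n = p = 2`) makes the AREA of the
`γ`-fast set super-exponentially small as well, with no symmetry.  This file proves a Mathlib-native
substitute that suffices for every use in the race: the planar Gagliardo–Nirenberg–Sobolev inequality with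
`p = 1` (`MeasureTheory.lintegral_pow_le_pow_lintegral_fderiv`, `‖u‖₂² ≤ C ‖∇u‖₁²` on `ℂ ≅ ℝ²`) applied to
the band test function of part A gives the

* ONE-BAND LAW `one_band`: for `F` continuous on `ℂ` and `C¹` on `ball 0 r`, levels `a < b`, radii
  `0 < r₁ < r₂ < r`:  `|{‖z‖ < r₁, F > b}| ≤ K · (A₀² / (r₂ − r₁)² + A₀ · E / (b − a)²)` whenever
  `A₀ ≥ |{‖z‖ < r₂, F > a}|`, `E ≥ ∫_{‖z‖<r₂, a<F<b} ‖F'‖²`, with ONE absolute constant `K = bandConst`;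

and `J` equal bands compound geometrically —
* BAND DECAY `band_decay`: if moreover `K J² A₀ ≤ (r₂ − r₁)²/8` and `8 K J E ≤ (b − a)²`, then
  `|{‖z‖ < r₁, F > b}| ≤ A₀ · e^{−J/4}`.

DICTIONARY (for the portrait; used in the sphere assembly t39c): on a good sphere `S_t` of an in-class profile,
`F` = the chart flux `−⟪y, V y⟫`, `b = γt²`, `a = γt²/2`, `A₀ ≍ c R^{−1−2ρ}/γ²` (Chebyshev), `E ≍ (c + C) R^{2−ρ}`,
so `J` may be taken `≍ γ² R^{2+ρ}/(C + c)`: the AREA of the fast set is `≤ exp(−c′ γ² R^{2+ρ}/(C + c))`, the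
same exponent as the in-radius bound of ROUND-36; for the race (`∀ m, … ≤ R^{−m}`) `J ≍ m log R` bands suffice.
WHAT THIS IS NOT: not crux E; not a statement about profiles; the Euler-side identification is t39c.
[GNS `p = 1`, `n = 2` (Mathlib); Cauchy–Schwarz; cf. Maz'ya §2.2.3 (6), Pólya–Szegő (condensers) — docstring-only]
-/

open MeasureTheory Set Metric Real Filter Topology
open scoped ENNReal NNReal

set_option linter.dupNamespace false

namespace Summit.NavierStokesRegularity.NavierStokesRegularity.Theorems.PowerGaugeEulerLiouville.NeedleBandLaw

open Summit.NavierStokesRegularity.NavierStokesRegularity.Theorems.PowerGaugeEulerLiouville.NeedleBandTest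

variable {F : ℂ → ℝ} {F' : ℂ → ℂ →L[ℝ] ℝ} {r r₁ r₂ a b : ℝ}
/-! ## 4. The one-band law -/

/-- The band energy `∫_{‖z‖<ρ, ℓ<F<ℓ'} ‖F'‖²` as a real number. -/
noncomputable def bandEnergy (F : ℂ → ℝ) (F' : ℂ → ℂ →L[ℝ] ℝ) (ρ ℓ ℓ' : ℝ) : ℝ :=
  (∫⁻ z in bandSet F ρ ℓ ℓ', ‖F' z‖ₑ ^ 2).toReal

/-- `0 ≤ bandEnergy`. -/
theorem bandEnergy_nonneg (F : ℂ → ℝ) (F' : ℂ → ℂ →L[ℝ] ℝ) (ρ ℓ ℓ' : ℝ) : 0 ≤ bandEnergy F F' ρ ℓ ℓ' :=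
  ENNReal.toReal_nonneg

/-- The planar Gagliardo–Nirenberg–Sobolev constant for `p = 1` (`‖u‖₂² ≤ C ‖∇u‖₁²` on `ℂ ≅ ℝ²`). -/
noncomputable def gnsConst : ℝ := (lintegralPowLePowLIntegralFDerivConst (volume : Measure ℂ) 2 : ℝ≥0)

/-- `0 ≤ gnsConst`. -/
theorem gnsConst_nonneg : 0 ≤ gnsConst := NNReal.coe_nonneg _
/-- THE constant of the band law: `8 · C_GNS · M²`. -/
noncomputable def bandConst : ℝ := 8 * gnsConst * clampBound ^ 2

/-- `0 ≤ bandConst`. -/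
theorem bandConst_nonneg : 0 ≤ bandConst := by unfold bandConst; have := gnsConst_nonneg; positivity

/-- ONE-BAND LAW.  For `F` continuous on `ℂ` and `C¹` on `ball 0 r`, levels `a < b`, radii `0 < r₁ < r₂ < r`:
`|{‖z‖ < r₁, F > b}| ≤ K · (A₀² / (r₂ − r₁)² + A₀ · E / (b − a)²)` whenever `A₀ ≥ |{‖z‖ < r₂, F > a}|` and
`E ≥ ∫_{‖z‖ < r₂, a < F < b} ‖F'‖²`.  [GNS `p = 1` in the plane applied to `ψ · φ((F − a)/(b − a))`;
Cauchy–Schwarz on the band; capacity–area heuristics: Maz'ya §2.2.3 — docstring-only] -/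
theorem one_band (hFc : Continuous F) (hF : ∀ z ∈ ball (0 : ℂ) r, HasFDerivAt F (F' z) z)
    (hF'c : ContinuousOn F' (ball (0 : ℂ) r)) (h₁ : 0 < r₁) (h₁₂ : r₁ < r₂) (h₂r : r₂ < r) (hab : a < b)
    {A₀ E : ℝ} (hA₀ : 0 ≤ A₀) (hE₀ : 0 ≤ E)
    (hA : volume (levSet F r₂ a) ≤ ENNReal.ofReal A₀)
    (hE : ∫⁻ z in bandSet F r₂ a b, ‖F' z‖ₑ ^ 2 ≤ ENNReal.ofReal E) :
    (volume (levSet F r₁ b)).toReal ≤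
      bandConst * (A₀ ^ 2 / (r₂ - r₁) ^ 2 + A₀ * E / (b - a) ^ 2) := by
  set A : Set ℂ := levSet F r₂ a with hAdef
  set B : Set ℂ := bandSet F r₂ a b with hBdef
  set T : Set ℂ := levSet F r₁ b with hTdef
  have hAm : MeasurableSet A := measurableSet_levSet hFc r₂ a
  have hBm : MeasurableSet B := measurableSet_bandSet hFc r₂ a b
  have hTm : MeasurableSet T := measurableSet_levSet hFc r₁ b
  have hBA : B ⊆ A := fun z hz => ⟨hz.1, hz.2.1⟩
  have hBr : B ⊆ ball (0 : ℂ) r := fun z hz => mem_ball_zero_iff.2 (hz.1.trans h₂r)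
  have hM := clampBound_pos
  set u := bandTest F a b r₁ r₂ with hudef
  have hu : ContDiff ℝ 1 u := contDiff_bandTest hF hF'c h₁ h₁₂ h₂r
  have h2u : HasCompactSupport u := hasCompactSupport_bandTest h₁ h₁₂
  -- (i) GNS and the lower bound `|T| ≤ ∫ u²`
  have hp : Real.HolderConjugate (Module.finrank ℝ ℂ : ℝ) 2 := by
    rw [Complex.finrank_real_complex]; exact_mod_cast Real.HolderConjugate.two_two
  have hGNS := lintegral_pow_le_pow_lintegral_fderiv (volume : Measure ℂ) hu h2u hp
  have hlow : volume T ≤ ∫⁻ z, ‖u z‖ₑ ^ (2 : ℝ) := by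
    calc volume T = ∫⁻ _ in T, 1 := by rw [setLIntegral_const, one_mul]
      _ ≤ ∫⁻ z in T, ‖u z‖ₑ ^ (2 : ℝ) := by
          refine setLIntegral_mono' hTm fun z hz => ?_
          rw [show u z = 1 from bandTest_eq_one h₁ h₁₂ hab hz.1.le hz.2.le]; simp
      _ ≤ ∫⁻ z, ‖u z‖ₑ ^ (2 : ℝ) := setLIntegral_le_lintegral _ _
  -- (ii) the gradient bound `∫ ‖∇u‖ ≤ C₁ |A| + C₂ ∫_B ‖F'‖`
  set C₁ : ℝ := 2 * clampBound / (r₂ - r₁) with hC₁def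
  set C₂ : ℝ := clampBound / (b - a) with hC₂def
  have hC₁ : 0 ≤ C₁ := div_nonneg (by linarith) (by linarith)
  have hC₂ : 0 ≤ C₂ := div_nonneg hM.le (by linarith)
  have hgrad : ∫⁻ z, ‖fderiv ℝ u z‖ₑ ≤
      ENNReal.ofReal C₁ * volume A + ENNReal.ofReal C₂ * ∫⁻ z in B, ‖F' z‖ₑ := by
    calc ∫⁻ z, ‖fderiv ℝ u z‖ₑ
        ≤ ∫⁻ z, (A.indicator (fun _ => ENNReal.ofReal C₁) z +
            B.indicator (fun w => ENNReal.ofReal C₂ * ‖F' w‖ₑ) z) := by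
          refine lintegral_mono fun z => ?_
          have h := norm_fderiv_bandTest_le (F := F) (a := a) (b := b) hF h₁ h₁₂ h₂r hab z
          rw [← ofReal_norm]
          refine (ENNReal.ofReal_le_ofReal h).trans (le_of_eq ?_)
          rw [ENNReal.ofReal_add (indicator_nonneg (fun _ _ => hC₁) _)
            (indicator_nonneg (fun _ _ => mul_nonneg hC₂ (norm_nonneg _)) _)]
          congr 1
          · by_cases hz : z ∈ A
            · rw [indicator_of_mem hz, indicator_of_mem hz]
            · rw [indicator_of_notMem hz, indicator_of_notMem hz, ENNReal.ofReal_zero]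
          · by_cases hz : z ∈ B
            · rw [indicator_of_mem hz, indicator_of_mem hz, ENNReal.ofReal_mul hC₂, ofReal_norm]
            · rw [indicator_of_notMem hz, indicator_of_notMem hz, ENNReal.ofReal_zero]
      _ = ENNReal.ofReal C₁ * volume A + ENNReal.ofReal C₂ * ∫⁻ z in B, ‖F' z‖ₑ := by
          rw [lintegral_add_left (measurable_const.indicator hAm), lintegral_indicator_const hAm,
            lintegral_indicator hBm, lintegral_const_mul' _ _ ENNReal.ofReal_ne_top]
  -- (iii) Cauchy–Schwarz on the band
  have hF'm : AEMeasurable (fun z => ‖F' z‖ₑ) (volume.restrict B) :=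
    ((hF'c.mono hBr).aemeasurable hBm).enorm
  have hCS : ∫⁻ z in B, ‖F' z‖ₑ ≤ volume B ^ (1 / 2 : ℝ) * (∫⁻ z in B, ‖F' z‖ₑ ^ 2) ^ (1 / 2 : ℝ) := by
    have h := ENNReal.lintegral_mul_le_Lp_mul_Lq (volume.restrict B) Real.HolderConjugate.two_two
      (f := fun _ : ℂ => (1 : ℝ≥0∞)) (g := fun z : ℂ => ‖F' z‖ₑ) aemeasurable_const hF'm
    simpa [ENNReal.rpow_two] using h
  -- (iv) finiteness and passage to real numbers
  have hAfin : volume A ≠ ⊤ := ne_top_of_le_ne_top ENNReal.ofReal_ne_top hA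
  have hEfin : ∫⁻ z in B, ‖F' z‖ₑ ^ 2 ≠ ⊤ := ne_top_of_le_ne_top ENNReal.ofReal_ne_top hE
  have hBfin : volume B ≠ ⊤ := ne_top_of_le_ne_top hAfin (measure_mono hBA)
  have hGfin : ∫⁻ z in B, ‖F' z‖ₑ ≠ ⊤ := ne_top_of_le_ne_top
    (ENNReal.mul_ne_top (ENNReal.rpow_ne_top_of_nonneg (by norm_num) hBfin)
      (ENNReal.rpow_ne_top_of_nonneg (by norm_num) hEfin)) hCS
  have hXfin : ∫⁻ z, ‖fderiv ℝ u z‖ₑ ≠ ⊤ := ne_top_of_le_ne_top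
    (ENNReal.add_ne_top.2 ⟨ENNReal.mul_ne_top ENNReal.ofReal_ne_top hAfin,
      ENNReal.mul_ne_top ENNReal.ofReal_ne_top hGfin⟩) hgrad
  set sA : ℝ := (volume A).toReal with hsAdef
  set eB : ℝ := (∫⁻ z in B, ‖F' z‖ₑ ^ 2).toReal with heBdef
  set gB : ℝ := (∫⁻ z in B, ‖F' z‖ₑ).toReal with hgBdef
  set X : ℝ := (∫⁻ z, ‖fderiv ℝ u z‖ₑ).toReal with hXdef
  have hsA0 : 0 ≤ sA := ENNReal.toReal_nonneg
  have heB0 : 0 ≤ eB := ENNReal.toReal_nonneg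
  have hgB0 : 0 ≤ gB := ENNReal.toReal_nonneg
  have hX0 : 0 ≤ X := ENNReal.toReal_nonneg
  have hsA : sA ≤ A₀ := ENNReal.toReal_le_of_le_ofReal hA₀ hA
  have hsB : (volume B).toReal ≤ sA := ENNReal.toReal_mono hAfin (measure_mono hBA)
  have heB : eB ≤ E := ENNReal.toReal_le_of_le_ofReal hE₀ hE
  -- Cauchy–Schwarz in real form: gB² ≤ sA · eB
  have hgB : gB ^ 2 ≤ sA * eB := by
    have h1 : gB ≤ Real.sqrt ((volume B).toReal) * Real.sqrt eB := by
      have := ENNReal.toReal_mono (ENNReal.mul_ne_top (ENNReal.rpow_ne_top_of_nonneg (by norm_num) hBfin)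
        (ENNReal.rpow_ne_top_of_nonneg (by norm_num) hEfin)) hCS
      rw [ENNReal.toReal_mul, ← ENNReal.toReal_rpow, ← ENNReal.toReal_rpow] at this
      rwa [Real.sqrt_eq_rpow, Real.sqrt_eq_rpow]
    have h2 : gB ^ 2 ≤ (Real.sqrt ((volume B).toReal) * Real.sqrt eB) ^ 2 := by gcongr
    calc gB ^ 2 ≤ (Real.sqrt ((volume B).toReal) * Real.sqrt eB) ^ 2 := h2
      _ = (volume B).toReal * eB := by
          rw [mul_pow, Real.sq_sqrt ENNReal.toReal_nonneg, Real.sq_sqrt heB0]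
      _ ≤ sA * eB := by gcongr
  -- the gradient bound in real form: X ≤ C₁ sA + C₂ gB
  have hX : X ≤ C₁ * sA + C₂ * gB := by
    have := ENNReal.toReal_mono (ENNReal.add_ne_top.2 ⟨ENNReal.mul_ne_top ENNReal.ofReal_ne_top hAfin,
      ENNReal.mul_ne_top ENNReal.ofReal_ne_top hGfin⟩) hgrad
    rwa [ENNReal.toReal_add (ENNReal.mul_ne_top ENNReal.ofReal_ne_top hAfin)
      (ENNReal.mul_ne_top ENNReal.ofReal_ne_top hGfin), ENNReal.toReal_mul, ENNReal.toReal_mul,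
      ENNReal.toReal_ofReal hC₁, ENNReal.toReal_ofReal hC₂] at this
  -- GNS in real form: |T| ≤ C_GNS · X²
  have hT : (volume T).toReal ≤ gnsConst * X ^ 2 := by
    have hfin : (lintegralPowLePowLIntegralFDerivConst (volume : Measure ℂ) 2 : ℝ≥0∞) *
        (∫⁻ z, ‖fderiv ℝ u z‖ₑ) ^ (2 : ℝ) ≠ ⊤ :=
      ENNReal.mul_ne_top ENNReal.coe_ne_top (ENNReal.rpow_ne_top_of_nonneg (by norm_num) hXfin)
    have := ENNReal.toReal_mono hfin (hlow.trans hGNS)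
    rw [ENNReal.toReal_mul, ← ENNReal.toReal_rpow, Real.rpow_two] at this
    simpa [gnsConst] using this
  -- (v) arithmetic
  have hC : 0 ≤ gnsConst := gnsConst_nonneg
  have step1 : X ^ 2 ≤ 2 * (C₁ * sA) ^ 2 + 2 * (C₂ * gB) ^ 2 := by
    have h0 : 0 ≤ C₁ * sA + C₂ * gB := by positivity
    nlinarith [sq_nonneg (C₁ * sA - C₂ * gB), mul_self_le_mul_self hX0 hX]
  have step2 : 2 * (C₁ * sA) ^ 2 + 2 * (C₂ * gB) ^ 2 ≤ 2 * C₁ ^ 2 * A₀ ^ 2 + 2 * C₂ ^ 2 * (A₀ * E) := by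
    have h1 : (C₁ * sA) ^ 2 ≤ C₁ ^ 2 * A₀ ^ 2 := by
      rw [mul_pow]; gcongr
    have h2 : (C₂ * gB) ^ 2 ≤ C₂ ^ 2 * (A₀ * E) := by
      rw [mul_pow]
      exact mul_le_mul_of_nonneg_left (hgB.trans (mul_le_mul hsA heB heB0 hA₀)) (sq_nonneg _)
    linarith
  have step3 : gnsConst * (2 * C₁ ^ 2 * A₀ ^ 2 + 2 * C₂ ^ 2 * (A₀ * E)) ≤
      bandConst * (A₀ ^ 2 / (r₂ - r₁) ^ 2 + A₀ * E / (b - a) ^ 2) := by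
    have hr : 0 < r₂ - r₁ := by linarith
    have hb : 0 < b - a := by linarith
    have e1 : gnsConst * (2 * C₁ ^ 2 * A₀ ^ 2) = bandConst * (A₀ ^ 2 / (r₂ - r₁) ^ 2) := by
      simp only [hC₁def, bandConst]; field_simp; ring
    have e2 : gnsConst * (2 * C₂ ^ 2 * (A₀ * E)) = (bandConst / 4) * (A₀ * E / (b - a) ^ 2) := by
      simp only [hC₂def, bandConst]; field_simp; ring
    have h3 : 0 ≤ bandConst * (A₀ * E / (b - a) ^ 2) := by
      have := bandConst_nonneg; positivity
    rw [mul_add, e1, e2]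
    nlinarith
  calc (volume T).toReal ≤ gnsConst * X ^ 2 := hT
    _ ≤ gnsConst * (2 * (C₁ * sA) ^ 2 + 2 * (C₂ * gB) ^ 2) := by gcongr
    _ ≤ gnsConst * (2 * C₁ ^ 2 * A₀ ^ 2 + 2 * C₂ ^ 2 * (A₀ * E)) := by gcongr
    _ ≤ _ := step3
/-! ## 5. Band decay: `J` equal bands compound geometrically -/

/-- The elementary inequality behind the compounding: `1/8 + x ≤ e^{2x}/2`. -/
theorem eighth_add_le_half_exp (x : ℝ) : 1 / 8 + x ≤ 1 / 2 * Real.exp (2 * x) := by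
  have := Real.add_one_le_exp (2 * x)
  linarith

/-- `(1/2)^J · e^{J/4} ≤ e^{−J/4}` (`log 2 > 1/2`). -/
theorem half_pow_mul_exp_le (J : ℕ) :
    (1 / 2 : ℝ) ^ J * Real.exp ((J : ℝ) / 4) ≤ Real.exp (-(J : ℝ) / 4) := by
  have h2 : (1 / 2 : ℝ) ^ J = Real.exp (-((J : ℝ) * Real.log 2)) := by
    rw [Real.exp_neg, Real.exp_nat_mul, Real.exp_log two_pos, one_div, inv_pow]
  rw [h2, ← Real.exp_add]
  apply Real.exp_le_exp.2
  have := Real.log_two_gt_d9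
  nlinarith [(Nat.cast_nonneg J : (0 : ℝ) ≤ J)]

/-- The real-variable step of the induction: from the one-band law `s' ≤ K (s²/η² + s e/δ²)`, the smallness
`K s/η² ≤ 1/8` and `s ≤ P` one gets `s' ≤ P · ½ e^{c e}` with `c = 2K/δ²`. -/
theorem decay_step {K s s' e η δ P : ℝ} (hK : 0 ≤ K) (hs : 0 ≤ s) (he : 0 ≤ e) (hδ : 0 < δ)
    (h : s' ≤ K * (s ^ 2 / η ^ 2 + s * e / δ ^ 2)) (h8 : K * s / η ^ 2 ≤ 1 / 8) (hP : s ≤ P) :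
    s' ≤ P * (1 / 2 * Real.exp (2 * K / δ ^ 2 * e)) := by
  have hP0 : 0 ≤ P := hs.trans hP
  have hx : K * (s ^ 2 / η ^ 2 + s * e / δ ^ 2) = s * (K * s / η ^ 2 + K * e / δ ^ 2) := by ring
  have hfac : K * s / η ^ 2 + K * e / δ ^ 2 ≤ 1 / 2 * Real.exp (2 * K / δ ^ 2 * e) := by
    have h1 := eighth_add_le_half_exp (K * e / δ ^ 2)
    rw [show 2 * (K * e / δ ^ 2) = 2 * K / δ ^ 2 * e by ring] at h1
    linarith
  have hfac0 : 0 ≤ K * s / η ^ 2 + K * e / δ ^ 2 := by positivity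
  calc s' ≤ s * (K * s / η ^ 2 + K * e / δ ^ 2) := hx ▸ h
    _ ≤ P * (1 / 2 * Real.exp (2 * K / δ ^ 2 * e)) := by gcongr

/-- The arithmetic ladder `lev a δ i = a + i δ`. -/
noncomputable def lev (a δ : ℝ) (i : ℕ) : ℝ := a + i * δ

/-- `lev a δ 0 = a`. -/
@[simp] theorem lev_zero (a δ : ℝ) : lev a δ 0 = a := by simp [lev]

/-- `lev a δ (i+1) = lev a δ i + δ`. -/
theorem lev_succ (a δ : ℝ) (i : ℕ) : lev a δ (i + 1) = lev a δ i + δ := by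
  simp only [lev]; push_cast; ring

/-- Monotonicity of the ladder in the index. -/
theorem lev_le_lev {a δ : ℝ} (hδ : 0 ≤ δ) {i i' : ℕ} (h : i ≤ i') : lev a δ i ≤ lev a δ i' := by
  simp only [lev]
  have : (i : ℝ) ≤ i' := by exact_mod_cast h
  nlinarith

/-- The ladder with step `(b − a)/J` reaches `b` at `J`. -/
theorem lev_div (a b : ℝ) {J : ℕ} (hJ : 0 < J) : lev a ((b - a) / J) J = b := by
  have : (J : ℝ) ≠ 0 := by exact_mod_cast hJ.ne'
  simp only [lev]; field_simp; ring

/-- BAND DECAY.  If `K J² A₀ ≤ (r₂ − r₁)²/8` and `8 K J E ≤ (b − a)²` (`K = bandConst`), where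
`A₀ ≥ |{‖z‖ < r₂, F > a}|` and `E ≥ ∫_{‖z‖ < r₂, a < F < b} ‖F'‖²`, then `|{‖z‖ < r₁, F > b}| ≤ A₀ · e^{−J/4}`:
the super-level AREA decays geometrically across `J` equal bands — the Lean-native form of the capacity–area
inequality (Maz'ya, Sobolev Spaces §2.2.3 (6): `|{F > b}| ≤ |{F > a}| · exp(−4π (b − a)² / ∫_{a<F<b} ‖∇F‖²)`,
docstring-only).  [`one_band` on the ladder `ℓ_j = a + j(b−a)/J`, `ρ_j = r₂ − j(r₂−r₁)/J`; `decay_step`] -/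
theorem band_decay (hFc : Continuous F) (hF : ∀ z ∈ ball (0 : ℂ) r, HasFDerivAt F (F' z) z)
    (hF'c : ContinuousOn F' (ball (0 : ℂ) r)) (h₁ : 0 < r₁) (h₁₂ : r₁ < r₂) (h₂r : r₂ < r) (hab : a < b)
    {A₀ E : ℝ} (hA₀ : 0 ≤ A₀) (hE₀ : 0 ≤ E)
    (hA : volume (levSet F r₂ a) ≤ ENNReal.ofReal A₀)
    (hE : ∫⁻ z in bandSet F r₂ a b, ‖F' z‖ₑ ^ 2 ≤ ENNReal.ofReal E)
    {J : ℕ} (hJ : 0 < J) (hJA : bandConst * (J : ℝ) ^ 2 * A₀ ≤ (r₂ - r₁) ^ 2 / 8)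
    (hJE : 8 * bandConst * (J : ℝ) * E ≤ (b - a) ^ 2) :
    (volume (levSet F r₁ b)).toReal ≤ A₀ * Real.exp (-(J : ℝ) / 4) := by
  have hK := bandConst_nonneg
  have hJr : (0 : ℝ) < J := by exact_mod_cast hJ
  -- the ladder: levels `ℓ i = lev a δ i`, radii `ρ i = lev r₂ (-η) i`
  set δ : ℝ := (b - a) / J with hδ
  set η : ℝ := (r₂ - r₁) / J with hη
  have hδpos : 0 < δ := div_pos (by linarith) hJr
  have hηpos : 0 < η := div_pos (by linarith) hJr
  have hℓJ : lev a δ J = b := lev_div a b hJ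
  have hρJ : lev r₂ (-η) J = r₁ := by
    rw [show -η = (r₁ - r₂) / J by rw [hη]; ring]; exact lev_div r₂ r₁ hJ
  have hℓge : ∀ i : ℕ, a ≤ lev a δ i := fun i => by
    simpa using lev_le_lev (a := a) hδpos.le (Nat.zero_le i)
  have hℓle : ∀ i : ℕ, i ≤ J → lev a δ i ≤ b := fun i hi => hℓJ ▸ lev_le_lev hδpos.le hi
  have hρle : ∀ i : ℕ, lev r₂ (-η) i ≤ r₂ := fun i => by
    simp only [lev]; nlinarith [hηpos.le, (Nat.cast_nonneg i : (0 : ℝ) ≤ i)]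
  have hρge : ∀ i : ℕ, i ≤ J → r₁ ≤ lev r₂ (-η) i := fun i hi => by
    rw [← hρJ]; simp only [lev]
    have : (i : ℝ) ≤ J := by exact_mod_cast hi
    nlinarith [hηpos.le]
  -- every rung lies inside the initial super-level set / the total band
  have hTsub : ∀ i, levSet F (lev r₂ (-η) i) (lev a δ i) ⊆ levSet F r₂ a := fun i z hz =>
    ⟨hz.1.trans_le (hρle i), (hℓge i).trans_lt hz.2⟩
  have hTfin : ∀ i, volume (levSet F (lev r₂ (-η) i) (lev a δ i)) ≠ ⊤ := fun i =>
    ne_top_of_le_ne_top ENNReal.ofReal_ne_top ((measure_mono (hTsub i)).trans hA)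
  have hTle : ∀ i, (volume (levSet F (lev r₂ (-η) i) (lev a δ i))).toReal ≤ A₀ := fun i =>
    ENNReal.toReal_le_of_le_ofReal hA₀ ((measure_mono (hTsub i)).trans hA)
  have hBdsub : ∀ i, i + 1 ≤ J → bandSet F r₂ (lev a δ i) (lev a δ (i + 1)) ⊆ bandSet F r₂ a b :=
    fun i hi z hz => ⟨hz.1, (hℓge i).trans_lt hz.2.1, hz.2.2.trans_le (hℓle (i + 1) hi)⟩
  have hBdfin : ∀ i, i + 1 ≤ J →
      ∫⁻ z in bandSet F r₂ (lev a δ i) (lev a δ (i + 1)), ‖F' z‖ₑ ^ 2 ≠ ⊤ := fun i hi =>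
    ne_top_of_le_ne_top ENNReal.ofReal_ne_top ((lintegral_mono_set (hBdsub i hi)).trans hE)
  -- the compounding constant `c = 2K/δ²`
  have hc0 : 0 ≤ 2 * bandConst / δ ^ 2 := by positivity
  -- induction over the rungs
  have key : ∀ j : ℕ, j ≤ J → (volume (levSet F (lev r₂ (-η) j) (lev a δ j))).toReal ≤
      A₀ * (1 / 2 : ℝ) ^ j *
        Real.exp (2 * bandConst / δ ^ 2 * ∑ i ∈ Finset.range j, bandEnergy F F' r₂ (lev a δ i) (lev a δ (i + 1))) := by
    intro j
    induction j with
    | zero =>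
      intro _
      simp only [lev_zero, pow_zero, mul_one, Finset.range_zero, Finset.sum_empty, mul_zero, Real.exp_zero]
      simpa using hTle 0
    | succ j ih =>
      intro hj
      have ih := ih (Nat.le_of_succ_le hj)
      have hr₁' : 0 < lev r₂ (-η) (j + 1) := h₁.trans_le (hρge (j + 1) hj)
      have hr₁₂' : lev r₂ (-η) (j + 1) < lev r₂ (-η) j := by rw [lev_succ]; linarith
      have hr₂' : lev r₂ (-η) j < r := (hρle j).trans_lt h₂r
      have hab' : lev a δ j < lev a δ (j + 1) := by rw [lev_succ]; linarith
      have hA' : volume (levSet F (lev r₂ (-η) j) (lev a δ j)) ≤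
          ENNReal.ofReal (volume (levSet F (lev r₂ (-η) j) (lev a δ j))).toReal := by
        rw [ENNReal.ofReal_toReal (hTfin j)]
      have hE' : ∫⁻ z in bandSet F (lev r₂ (-η) j) (lev a δ j) (lev a δ (j + 1)), ‖F' z‖ₑ ^ 2 ≤
          ENNReal.ofReal (bandEnergy F F' r₂ (lev a δ j) (lev a δ (j + 1))) := by
        rw [bandEnergy, ENNReal.ofReal_toReal (hBdfin j hj)]
        exact lintegral_mono_set fun z hz => ⟨hz.1.trans_le (hρle j), hz.2⟩
      have hband := one_band hFc hF hF'c hr₁' hr₁₂' hr₂' hab' ENNReal.toReal_nonneg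
        (bandEnergy_nonneg F F' r₂ _ _) hA' hE'
      rw [show lev r₂ (-η) j - lev r₂ (-η) (j + 1) = η by rw [lev_succ]; ring,
        show lev a δ (j + 1) - lev a δ j = δ by rw [lev_succ]; ring] at hband
      have h8 : bandConst * (volume (levSet F (lev r₂ (-η) j) (lev a δ j))).toReal / η ^ 2 ≤ 1 / 8 := by
        rw [div_le_iff₀ (by positivity)]
        calc bandConst * (volume (levSet F (lev r₂ (-η) j) (lev a δ j))).toReal
            ≤ bandConst * A₀ := by gcongr; exact hTle j
          _ = bandConst * (J : ℝ) ^ 2 * A₀ / (J : ℝ) ^ 2 := by field_simp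
          _ ≤ (r₂ - r₁) ^ 2 / 8 / (J : ℝ) ^ 2 := by gcongr
          _ = 1 / 8 * η ^ 2 := by rw [hη]; field_simp
      have hstep := decay_step hK ENNReal.toReal_nonneg (bandEnergy_nonneg F F' r₂ _ _) hδpos hband h8 ih
      calc (volume (levSet F (lev r₂ (-η) (j + 1)) (lev a δ (j + 1)))).toReal
          ≤ _ := hstep
        _ = _ := by rw [Finset.sum_range_succ, mul_add, Real.exp_add, pow_succ]; ring
  -- the total band energy is at most `E` (the bands are disjoint)
  have hsum : ∑ i ∈ Finset.range J, bandEnergy F F' r₂ (lev a δ i) (lev a δ (i + 1)) ≤ E := by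
    have hdisj : Set.PairwiseDisjoint (↑(Finset.range J) : Set ℕ)
        (fun i => bandSet F r₂ (lev a δ i) (lev a δ (i + 1))) := by
      intro i _ i' _ hne
      rcases Nat.lt_or_gt_of_ne hne with h | h
      · exact Set.disjoint_left.2 fun z hz hz' => by
          have : lev a δ (i + 1) ≤ lev a δ i' := lev_le_lev hδpos.le h
          exact absurd (hz.2.2.trans_le this) (not_lt.2 hz'.2.1.le)
      · exact Set.disjoint_left.2 fun z hz hz' => by
          have : lev a δ (i' + 1) ≤ lev a δ i := lev_le_lev hδpos.le h
          exact absurd (hz'.2.2.trans_le this) (not_lt.2 hz.2.1.le)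
    have hmeas : ∀ i ∈ Finset.range J, MeasurableSet (bandSet F r₂ (lev a δ i) (lev a δ (i + 1))) :=
      fun i _ => measurableSet_bandSet hFc r₂ _ _
    have hU : ∫⁻ z in ⋃ i ∈ Finset.range J, bandSet F r₂ (lev a δ i) (lev a δ (i + 1)), ‖F' z‖ₑ ^ 2 ≤
        ENNReal.ofReal E := by
      refine (lintegral_mono_set ?_).trans hE
      intro z hz
      simp only [Set.mem_iUnion, Finset.mem_range, exists_prop] at hz
      obtain ⟨i, hi, hz⟩ := hz
      exact hBdsub i hi hz
    rw [lintegral_biUnion_finset hdisj hmeas] at hU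
    have hfin : ∀ i ∈ Finset.range J,
        ∫⁻ z in bandSet F r₂ (lev a δ i) (lev a δ (i + 1)), ‖F' z‖ₑ ^ 2 ≠ ⊤ := fun i hi =>
      hBdfin i (Finset.mem_range.1 hi)
    calc ∑ i ∈ Finset.range J, bandEnergy F F' r₂ (lev a δ i) (lev a δ (i + 1))
        = (∑ i ∈ Finset.range J, ∫⁻ z in bandSet F r₂ (lev a δ i) (lev a δ (i + 1)), ‖F' z‖ₑ ^ 2).toReal := by
          rw [ENNReal.toReal_sum hfin]; rfl
      _ ≤ E := ENNReal.toReal_le_of_le_ofReal hE₀ hU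
  -- conclusion
  have hfinal := key J le_rfl
  rw [hρJ, hℓJ] at hfinal
  have hcE : 2 * bandConst / δ ^ 2 * ∑ i ∈ Finset.range J, bandEnergy F F' r₂ (lev a δ i) (lev a δ (i + 1)) ≤
      (J : ℝ) / 4 := by
    calc 2 * bandConst / δ ^ 2 * ∑ i ∈ Finset.range J, bandEnergy F F' r₂ (lev a δ i) (lev a δ (i + 1))
        ≤ 2 * bandConst / δ ^ 2 * E := by gcongr
      _ = (8 * bandConst * (J : ℝ) * E) * ((J : ℝ) / (4 * (b - a) ^ 2)) := by
          rw [hδ]; field_simp; ring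
      _ ≤ (b - a) ^ 2 * ((J : ℝ) / (4 * (b - a) ^ 2)) := by gcongr
      _ = (J : ℝ) / 4 := by
          have hb : (b - a) ^ 2 ≠ 0 := by positivity
          rw [← mul_div_assoc, mul_comm (4 : ℝ), mul_div_mul_left _ _ hb]
  calc (volume (levSet F r₁ b)).toReal
      ≤ A₀ * (1 / 2 : ℝ) ^ J *
          Real.exp (2 * bandConst / δ ^ 2 * ∑ i ∈ Finset.range J, bandEnergy F F' r₂ (lev a δ i) (lev a δ (i + 1))) :=
        hfinal
    _ ≤ A₀ * (1 / 2 : ℝ) ^ J * Real.exp ((J : ℝ) / 4) := by gcongr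
    _ = A₀ * ((1 / 2 : ℝ) ^ J * Real.exp ((J : ℝ) / 4)) := by ring
    _ ≤ A₀ * Real.exp (-(J : ℝ) / 4) := by gcongr; exact half_pow_mul_exp_le J

end Summit.NavierStokesRegularity.NavierStokesRegularity.Theorems.PowerGaugeEulerLiouville.NeedleBandLaw
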